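import Summits.Schanuel.Schanuel.Theorems.ZilberEacBranchCycleMaster
import Summits.Schanuel.Schanuel.Theorems.ZilberEacCurveGraphFibreCase
import Summits.Schanuel.Schanuel.Theorems.ZilberEacGraphReciprocalExamples
import HarnessLib

/-!
# Arbitrary base branches, X: a base curve with TWO PLACES AT INFINITY — over
# `x₀x₁ = x₀³ + 1` (`x₁ = x₀² + 1/x₀`), the surface `y₀ = x₁ - x₀² + 1` is in the case AND dense

HONEST FRAMING.  Cell `pub-schanuel` (Zilber's Exponential-Algebraic Closedness, case ladder;
host summit Schanuel), seat 2, gen 28.  The rational curve `C : x₀x₁ - x₀³ - 1 = 0` is the graph of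
the LAURENT polynomial `x₁ = x₀² + 1/x₀`; it has two places at infinity (`x₀ → ∞`, `x₁ ~ x₀²`, and
the vertical asymptote `x₀ → 0`), so it is neither a polynomial graph nor polynomially
parametrised — outside every base class of gens 8–27.  Along the first place, `x₀ = 1/s`,
`x₁ = (1 + s³)/s²` (`k = 1 < M = 2`, `Φ = 1 + s³` — a polynomial, no Puiseux needed), the regular
function `R = x₁ - x₀² + 1 = 1 + 1/x₀` is `ψ(s) = 1 + s → θ = 1`; the fibre relation is
`F = x₀y₀ - x₀ - 1` (zero `y₀ = 0` over `x₀ = -1`).  The master theorem (file V) and the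
certificates (files VI, VIII) give **`unprojectedDensityQuestion_instance_laurentGraph`**: the
surface `S = {x₀x₁ - x₀³ - 1 = 0, y₀ = x₁ - x₀² + 1}` is in Mantova–Masser's case (dim-π-S-1-free)
AND `I(S ∩ Γ_exp) = I(S)`.  A decided instance of an OPEN question (Mantova–Masser, PLMS 2024 §1
p. 5); EC(3,2) OPEN; NOT Schanuel's conjecture (neither used nor implied); EAC ⇏ SC.
-/

noncomputable section

open Filter Topology Set Complex MvPolynomial
open Literature.NumberTheory.Transcendental Literature.ModelTheory.Zilber
open Literature.ModelTheory.ExponentialFields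

set_option linter.dupNamespace false

namespace Summit.Schanuel.Schanuel.Theorems

/-! ## Part A. Algebra -/

/-- Evaluation of a row polynomial `a(s) t + b(s)` at `(x, y)`. [folklore] -/
theorem evalPP_linear (a b : Polynomial ℂ) (x y : ℂ) :
    ((Polynomial.C a * Polynomial.X + Polynomial.C b).map (Polynomial.evalRingHom x)).eval y =
      a.eval x * y + b.eval x := by
  simp

/-- The base relation `s t - (s³ + 1)` (`x₀x₁ - x₀³ - 1`) is irreducible in `ℂ[s][t]`. [folklore] -/
theorem irreducible_laurentGraph_baseRow :
    Irreducible (Polynomial.C (Polynomial.X : Polynomial ℂ) * Polynomial.X +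
      Polynomial.C (-(Polynomial.X ^ 3 + 1) : Polynomial ℂ)) :=
  irreducible_C_mul_X_add_C_of_isCoprime Polynomial.X_ne_zero ⟨-Polynomial.X ^ 2, -1, by ring⟩

/-- The fibre relation `s t - (s + 1)` (`x₀y₀ - x₀ - 1`) is irreducible in `ℂ[s][t]`. [folklore] -/
theorem irreducible_laurentGraph_fibreRow :
    Irreducible (Polynomial.C (Polynomial.X : Polynomial ℂ) * Polynomial.X +
      Polynomial.C (-(Polynomial.X + 1) : Polynomial ℂ)) :=
  irreducible_C_mul_X_add_C_of_isCoprime Polynomial.X_ne_zero ⟨-1, -1, by ring⟩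

/-- Evaluation of the base polynomial `x₀x₁ - x₀³ - 1`. -/
theorem eval_laurentGraph_baseMv (x : Fin 2 → ℂ) :
    MvPolynomial.eval x (X 0 * X 1 - X 0 ^ 3 - 1 : MvPolynomial (Fin 2) ℂ) =
      x 0 * x 1 - x 0 ^ 3 - 1 := by
  simp

/-- The base polynomial and its rows. -/
theorem eval_laurentGraph_baseMv_rows (x y : ℂ) :
    MvPolynomial.eval ![x, y] (X 0 * X 1 - X 0 ^ 3 - 1 : MvPolynomial (Fin 2) ℂ) =
      ((Polynomial.C (Polynomial.X : Polynomial ℂ) * Polynomial.X +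
        Polynomial.C (-(Polynomial.X ^ 3 + 1) : Polynomial ℂ)).map (Polynomial.evalRingHom x)).eval y := by
  rw [evalPP_linear, eval_laurentGraph_baseMv]
  simp
  ring

/-- The base polynomial `x₀x₁ - x₀³ - 1` is irreducible in `ℂ[x₀, x₁]`. [folklore] -/
theorem irreducible_laurentGraph_baseMv :
    Irreducible (X 0 * X 1 - X 0 ^ 3 - 1 : MvPolynomial (Fin 2) ℂ) :=
  (irreducible_rows_iff eval_laurentGraph_baseMv_rows).2 irreducible_laurentGraph_baseRow

/-! ## Part B. Density -/

/-- **Over `x₀x₁ = x₀³ + 1`, the surface `y₀ = x₁ - x₀² + 1` has Zariski-dense exponential points.**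
[cite: MantovaMasser2023, §1 Further remarks, p. 5 (the question, open in general)] (new) -/
theorem unprojectedDense_laurentGraph :
    UnprojectedDense {w : Fin 2 ⊕ Fin 2 → ℂ |
      MvPolynomial.eval ![w (Sum.inl 0), w (Sum.inl 1)]
        (X 0 * X 1 - X 0 ^ 3 - 1 : MvPolynomial (Fin 2) ℂ) = 0 ∧
      w (Sum.inr 0) = MvPolynomial.eval ![w (Sum.inl 0), w (Sum.inl 1)]
        (X 1 - X 0 ^ 2 + 1 : MvPolynomial (Fin 2) ℂ)} := by
  have hS := isIrreducibleClosed_curveGraphFibre (X 1 - X 0 ^ 2 + 1 : MvPolynomial (Fin 2) ℂ)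
    irreducible_laurentGraph_baseMv
  have hdim := zariskiDim_curveGraphFibre (X 1 - X 0 ^ 2 + 1 : MvPolynomial (Fin 2) ℂ)
    irreducible_laurentGraph_baseMv
  set Arow : Polynomial (Polynomial ℂ) := Polynomial.C (Polynomial.X : Polynomial ℂ) * Polynomial.X +
      Polynomial.C (-(Polynomial.X ^ 3 + 1) : Polynomial ℂ) with hArow
  set Frow : Polynomial (Polynomial ℂ) := Polynomial.C (Polynomial.X : Polynomial ℂ) * Polynomial.X +
      Polynomial.C (-(Polynomial.X + 1) : Polynomial ℂ) with hFrow
  have hAirr : Irreducible Arow := irreducible_laurentGraph_baseRow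
  have hFirr : Irreducible Frow := irreducible_laurentGraph_fibreRow
  have hA1 : Arow.natDegree ≠ 0 := by
    rw [hArow, Polynomial.natDegree_linear Polynomial.X_ne_zero]; exact one_ne_zero
  have hF1 : Frow.natDegree ≠ 0 := by
    rw [hFrow, Polynomial.natDegree_linear Polynomial.X_ne_zero]; exact one_ne_zero
  have hFcoeff0 : Frow.coeff 0 = -(Polynomial.X + 1) := by
    rw [hFrow, Polynomial.coeff_add, Polynomial.coeff_C_mul_X, Polynomial.coeff_C_zero]
    simp
  have hF00 : Frow.coeff 0 ≠ 0 := by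
    rw [hFcoeff0, neg_ne_zero]
    intro h
    have := congrArg (Polynomial.eval (0 : ℂ)) h
    simp at this
  have ha : (Frow.coeff 0).IsRoot (-1) := by rw [hFcoeff0]; simp
  have hAeval : ∀ x y : ℂ, (Arow.map (Polynomial.evalRingHom x)).eval y = x * y - x ^ 3 - 1 := by
    intro x y; rw [hArow, evalPP_linear]; simp; ring
  have hFeval : ∀ x y : ℂ, (Frow.map (Polynomial.evalRingHom x)).eval y = x * y - x - 1 := by
    intro x y; rw [hFrow, evalPP_linear]; simp; ring
  -- the branch `x₀ = 1/s`, `x₁ = (1 + s³)/s²`, `y₀ = 1 + s`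
  set Φ : ℂ → ℂ := fun s => 1 + s ^ 3 with hΦ
  set ψ : ℂ → ℂ := fun s => 1 + s with hψ
  have hΦan : AnalyticAt ℂ Φ 0 := analyticAt_const.add (analyticAt_id.pow 3)
  have hψan : AnalyticAt ℂ ψ 0 := analyticAt_const.add analyticAt_id
  have hΦ0 : Φ 0 ≠ 0 := by simp [hΦ]
  have hψ0 : ψ 0 = 1 := by simp [hψ]
  have hbranch : ∀ᶠ s in 𝓝[≠] (0 : ℂ),
      (Frow.map (Polynomial.evalRingHom (s ^ 1)⁻¹)).eval (ψ s) = 0 := by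
    filter_upwards [self_mem_nhdsWithin] with s (hs : s ≠ 0)
    rw [hFeval, pow_one, hψ]
    field_simp
    ring
  have hbase : ∀ᶠ s in 𝓝[≠] (0 : ℂ),
      (Arow.map (Polynomial.evalRingHom (s ^ 1)⁻¹)).eval (Φ s * (s ^ 2)⁻¹) = 0 := by
    filter_upwards [self_mem_nhdsWithin] with s (hs : s ≠ 0)
    rw [hAeval, pow_one, hΦ]
    field_simp
    ring
  have hgerm : ∀ᶠ s in 𝓝[≠] (0 : ℂ),
      (Sum.elim ![(s ^ 1)⁻¹, Φ s * (s ^ 2)⁻¹] ![ψ s, Complex.exp (Φ s * (s ^ 2)⁻¹)] :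
        Fin 2 ⊕ Fin 2 → ℂ) ∈ {w : Fin 2 ⊕ Fin 2 → ℂ |
      MvPolynomial.eval ![w (Sum.inl 0), w (Sum.inl 1)]
        (X 0 * X 1 - X 0 ^ 3 - 1 : MvPolynomial (Fin 2) ℂ) = 0 ∧
      w (Sum.inr 0) = MvPolynomial.eval ![w (Sum.inl 0), w (Sum.inl 1)]
        (X 1 - X 0 ^ 2 + 1 : MvPolynomial (Fin 2) ℂ)} := by
    filter_upwards [self_mem_nhdsWithin, hbase] with s (hs : s ≠ 0) hA
    refine ⟨?_, ?_⟩
    · simp only [Sum.elim_inl, Matrix.cons_val_zero, Matrix.cons_val_one]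
      rw [eval_laurentGraph_baseMv_rows]
      exact hA
    · simp only [Sum.elim_inr, Sum.elim_inl, Matrix.cons_val_zero, Matrix.cons_val_one]
      simp only [map_add, map_sub, map_pow, map_one, MvPolynomial.eval_X, Matrix.cons_val_one,
        Matrix.cons_val_zero, pow_one, hψ, hΦ]
      field_simp
      ring
  obtain ⟨e, η, he, hηan, hη0, hηne, hFη⟩ := exists_zeroBranch_puiseux Frow hFirr hF1 hF00 ha
  exact unprojectedDense_branch_cycle_zeroBranch hS (le_of_eq hdim) Frow hFirr hF1 Arow hAirr hA1
    (le_refl 1) (le_refl 2) hψan one_ne_zero hψ0 hΦan hΦ0 hbranch hbase hgerm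
    (analyticAt_const.add (analyticAt_id.pow e)) hηan hη0 (deriv_newtonBase_ne_zero (-1) he) hηne hFη

/-! ## Part C. The case certificate, and case ∧ dense -/

/-- **The Laurent-graph example is in Mantova–Masser's case (dim-π-S-1-free).** (new) -/
theorem mmCase_laurentGraph :
    MMCaseDimPiOneFree {w : Fin 2 ⊕ Fin 2 → ℂ |
      MvPolynomial.eval ![w (Sum.inl 0), w (Sum.inl 1)]
        (X 0 * X 1 - X 0 ^ 3 - 1 : MvPolynomial (Fin 2) ℂ) = 0 ∧
      w (Sum.inr 0) = MvPolynomial.eval ![w (Sum.inl 0), w (Sum.inl 1)]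
        (X 1 - X 0 ^ 2 + 1 : MvPolynomial (Fin 2) ℂ)} := by
  refine mmCase_curveGraphFibre irreducible_laurentGraph_baseMv ?_ ?_
  · -- the point `(1, 2)` of `C` has `R = 2 ≠ 0`
    refine ⟨![1, 2], ?_, ?_⟩
    · rw [eval_laurentGraph_baseMv]; norm_num
    · norm_num
  · -- `C` contains `(1, 2)`, `(-1, 0)`, `(2, 9/2)`: not on one line
    intro m hm c
    by_cases h1 : (m 0 : ℂ) * 1 + (m 1 : ℂ) * 2 ≠ c
    · refine ⟨![1, 2], ?_, ?_⟩
      · rw [eval_laurentGraph_baseMv]; norm_num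
      · simpa using h1
    by_cases h2 : (m 0 : ℂ) * (-1) + (m 1 : ℂ) * 0 ≠ c
    · refine ⟨![-1, 0], ?_, ?_⟩
      · rw [eval_laurentGraph_baseMv]; norm_num
      · simpa using h2
    push Not at h1 h2
    refine ⟨![2, 9 / 2], ?_, ?_⟩
    · rw [eval_laurentGraph_baseMv]; norm_num
    · simp only [Matrix.cons_val_zero, Matrix.cons_val_one]
      intro h3
      have hm0 : (m 0 : ℂ) = 0 := by
        linear_combination (3 / 2 : ℂ) * h1 + (-(5 / 6) : ℂ) * h2 + (-(2 / 3) : ℂ) * h3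
      have hm1 : (m 1 : ℂ) = 0 := by
        linear_combination (1 / 2 : ℂ) * h1 - (1 / 2 : ℂ) * h2 - hm0
      apply hm
      funext i
      fin_cases i
      · exact_mod_cast hm0
      · exact_mod_cast hm1

/-- **Mantova–Masser's question for the Laurent-graph example: case ∧ dense.**
[cite: MantovaMasser2023, §1 Further remarks, p. 5 (the question, open in general)] (new) -/
theorem unprojectedDensityQuestion_instance_laurentGraph :
    MMCaseDimPiOneFree {w : Fin 2 ⊕ Fin 2 → ℂ |
        MvPolynomial.eval ![w (Sum.inl 0), w (Sum.inl 1)]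
          (X 0 * X 1 - X 0 ^ 3 - 1 : MvPolynomial (Fin 2) ℂ) = 0 ∧
        w (Sum.inr 0) = MvPolynomial.eval ![w (Sum.inl 0), w (Sum.inl 1)]
          (X 1 - X 0 ^ 2 + 1 : MvPolynomial (Fin 2) ℂ)} ∧
      UnprojectedDense {w : Fin 2 ⊕ Fin 2 → ℂ |
        MvPolynomial.eval ![w (Sum.inl 0), w (Sum.inl 1)]
          (X 0 * X 1 - X 0 ^ 3 - 1 : MvPolynomial (Fin 2) ℂ) = 0 ∧
        w (Sum.inr 0) = MvPolynomial.eval ![w (Sum.inl 0), w (Sum.inl 1)]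
          (X 1 - X 0 ^ 2 + 1 : MvPolynomial (Fin 2) ℂ)} :=
  ⟨mmCase_laurentGraph, unprojectedDense_laurentGraph⟩

/-- **Plain coordinates**: `{x₀x₁ - x₀³ - 1 = 0, y₀ = x₁ - x₀² + 1}` is in the case AND has
Zariski-dense exponential points.
[cite: MantovaMasser2023, §1 Further remarks, p. 5 (the question, open in general)] (new) -/
theorem unprojectedDensityQuestion_instance_laurentGraph' :
    MMCaseDimPiOneFree {w : Fin 2 ⊕ Fin 2 → ℂ |
        w (Sum.inl 0) * w (Sum.inl 1) - w (Sum.inl 0) ^ 3 - 1 = 0 ∧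
        w (Sum.inr 0) = w (Sum.inl 1) - w (Sum.inl 0) ^ 2 + 1} ∧
      UnprojectedDense {w : Fin 2 ⊕ Fin 2 → ℂ |
        w (Sum.inl 0) * w (Sum.inl 1) - w (Sum.inl 0) ^ 3 - 1 = 0 ∧
        w (Sum.inr 0) = w (Sum.inl 1) - w (Sum.inl 0) ^ 2 + 1} := by
  have e : {w : Fin 2 ⊕ Fin 2 → ℂ |
      MvPolynomial.eval ![w (Sum.inl 0), w (Sum.inl 1)]
        (X 0 * X 1 - X 0 ^ 3 - 1 : MvPolynomial (Fin 2) ℂ) = 0 ∧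
      w (Sum.inr 0) = MvPolynomial.eval ![w (Sum.inl 0), w (Sum.inl 1)]
        (X 1 - X 0 ^ 2 + 1 : MvPolynomial (Fin 2) ℂ)} =
      {w : Fin 2 ⊕ Fin 2 → ℂ | w (Sum.inl 0) * w (Sum.inl 1) - w (Sum.inl 0) ^ 3 - 1 = 0 ∧
        w (Sum.inr 0) = w (Sum.inl 1) - w (Sum.inl 0) ^ 2 + 1} := by
    ext w
    simp
  have h := unprojectedDensityQuestion_instance_laurentGraph
  rw [e] at h
  exact h

end Summit.Schanuel.Schanuel.Theorems
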